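import Literature.NumberTheory.LFunctions.FordLogZetaIntegralBound
import Literature.NumberTheory.LFunctions.KhaleLemma51
import Literature.NumberTheory.LFunctions.SiegelAbelSummation
import HarnessLib

/-!
# Khale 2024, Lemma 5.2: `∫ log|L(σ + it + iau, χ)|/cosh²u du` under the Hurwitz bound (2.4)

Topic `Literature/NumberTheory/LFunctions`.  Everything in this file is PROVED; no definition, no
named fact.  **Lemma 5.2 of T. Khale, *An explicit Vinogradov–Korobov zero-free region for
Dirichlet L-functions*, Q. J. Math. 75 (2024) = arXiv:2210.06457v1 (pp. 8–11)** — "a variant of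
[Ford, *Zero-free regions for the Riemann zeta function*, Lemma 3.4]", whose `ζ` version is the
tree's `integral_log_norm_zeta_div_cosh_sq_le` (`FordLogZetaIntegralBound.lean`):

> Let `q ≥ 3`, `χ` (mod `q`). Fix `σ ∈ [1/2, 1)`, `a ∈ (0, 1/2]`. Assume (2.4) holds with `A, B > 0`.
> Suppose `1 − σ ≥ 1.92 (log(t/100))^{−2/3}`, `t ≥ max{q^{1/100000}, e^{1938}}` (5.1). Then
> `∫_{−∞}^{∞} log|L(σ + it + iau, χ)|/cosh²u du ≤ 2(log(A+1) + (1−σ) log q + B(1−σ)^{3/2} log t + ⅔ log log t)` (5.2).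

## Proof (the printed one, on Ford's skeleton as formalized in the tree)

Khale: "The estimates (5.4) and (5.7)–(5.10), along with `∫ sech² = 2`, yield [(5.2)] `+ E`", and
`E ≤ 0` by "the final lines of the proof of [Ford, Lemma 3.4], mutatis mutandis".  We run the tree's
formalization of those final lines (`FordL34.integral_upper_le`, `integral_lower_excess_le`,
`numerics_lower`, `numerics_upper`: the Taylor terms of `log(1 + au/t)` leave a negative
`−c a²/(12t²)`) for an ARBITRARY function `f(y)` in place of `log|ζ(σ + iy)|`
(`KhaleL52.integral_div_cosh_sq_le_generic`), with:

* the envelope `f(y) ≤ log X + Y log T + Z log log T` assumed only for `θt ≤ |y| ≤ T` (Khale's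
  "`u ∉ S`"; `θ = 1/100`: `S ⊆ {u ≤ −0.99 t/a}`), used at `T = |y|` (Cases 3–5) and `T = t`;
* one exceptional window `|y| < θt` (Khale's Cases 1–2, `|t + au| ≤ 3` and `u ∈ S`) where only
  `f(y) ≤ log X + Y log t + Z log log t + K` is assumed; its weight `4e^{−2(1−θ)t/a} · 2θt/a`
  must be small against `a²/(240 t² log t)` (two explicit numerical side conditions, the
  analogues of the tree's `hLnum`).

For `f(y) = log|L(σ + iy, χ)|`, `X = (A+1)q^{1−σ}`, `Y = B(1−σ)^{3/2}`, `Z = 2/3`: the envelope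
for `|y| ≥ t/100` is Lemma 5.1 plus (5.1) (`1.92(q^{1−σ}−1)/(1−σ) ≤ q^{1−σ}(log(t/100))^{2/3} ≤
q^{1−σ}|y|^Y(log|y|)^{2/3}`, Khale's (5.3)); on the window, Lemma 5.1 at `T = t` for `|y| ≥ 3` and
the crude `|L(s, χ)| ≤ 3q|s|` (partial summation, the tree's `DirichletAbel.norm_LFunction_le`;
Khale's Case 1 has `2q|s|`) with `q ≤ t^{100000}` for `|y| < 3`, giving `K = 100001 log t + 3`;
and for `t ≥ e^{1938}`, `a ≤ 1/2` the side conditions hold with astronomical room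
(`KhaleL52.numerics_window₁/₂`).  The integral is Lean's Bochner integral (`0` if not integrable,
which only helps) and `log|L|` is `Real.log ‖L‖` (`0` at zeros), as on the `ζ` side.

## Main statements

* `KhaleL52.integral_div_cosh_sq_le_generic` — Ford's Lemma 3.4 mechanism for an arbitrary `f`
  with an exceptional window.
* `KhaleL52.lemma52` — **Lemma 5.2** for every non-principal `χ` mod `q ≥ 3`.

## References

* T. Khale, arXiv:2210.06457v1, Lemma 5.2 and its proof (pp. 8–11). [Khale2024]
* K. Ford, *Zero-free regions for the Riemann zeta function* (2002), Lemma 3.4 (proof).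
  [Ford2002Millennium]
-/

noncomputable section

open Complex Real MeasureTheory Set Filter
open scoped Topology

namespace Literature.NumberTheory.LFunctions

namespace KhaleL52

open FordL34 Literature.Analysis.SpecialFunctions

/-! ## Pointwise bounds from the envelope `f(y) ≤ log X + Y log T + Z log log T` (`θt ≤ |y| ≤ T`) -/

section pointwise

variable {f : ℝ → ℝ} {LX Y Z t θ : ℝ}

/-- **Main range** `θt ≤ |y| ≤ t`: the envelope at `T = t`. [cite: Khale2024, Lemma 5.2 (proof)] -/
theorem le_main (ht : 3 ≤ t)
    (hmain : ∀ T : ℝ, 3 ≤ T → ∀ y : ℝ, θ * t ≤ |y| → |y| ≤ T →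
      f y ≤ LX + Y * Real.log T + Z * Real.log (Real.log T))
    {y : ℝ} (hy1 : θ * t ≤ |y|) (hyt : |y| ≤ t) :
    f y ≤ LX + Y * Real.log t + Z * Real.log (Real.log t) :=
  hmain t ht y hy1 hyt

/-- **Upper range** `y ≥ θt` (`θt ≥ 3`): with `x = y/t − 1`,
`f(y) ≤ log X + Y log t + Z log log t + (Y + Z/log t)(x − x²/2 + x³/3)` (the envelope at `T = y`,
`log(1 + x) ≤ x − x²/2 + x³/3` twice; Khale's Cases 3–4, (5.8)–(5.9)).
[cite: Khale2024, Lemma 5.2 (proof)] [cite: Ford2002Millennium, proof of Lemma 3.4] -/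
theorem le_upper (hY : 0 ≤ Y) (hZ : 0 ≤ Z) (ht : 3 ≤ t) (hθt : 3 ≤ θ * t)
    (hmain : ∀ T : ℝ, 3 ≤ T → ∀ y : ℝ, θ * t ≤ |y| → |y| ≤ T →
      f y ≤ LX + Y * Real.log T + Z * Real.log (Real.log T))
    {y : ℝ} (hy : θ * t ≤ y) :
    f y ≤ LX + Y * Real.log t + Z * Real.log (Real.log t)
      + (Y + Z / Real.log t) * ((y / t - 1) - (y / t - 1) ^ 2 / 2 + (y / t - 1) ^ 3 / 3) := by
  set x : ℝ := y / t - 1 with hx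
  set g : ℝ := x - x ^ 2 / 2 + x ^ 3 / 3 with hg
  have hy3 : 3 ≤ y := hθt.trans hy
  have ht0 : 0 < t := by linarith
  have hy0 : 0 < y := by linarith
  have hℓ : 0 < Real.log t := Real.log_pos (by linarith)
  have hly : 0 < Real.log y := Real.log_pos (by linarith)
  have hx1 : -1 < x := by
    have : 0 < y / t := div_pos hy0 ht0
    simp only [hx]; linarith
  -- the envelope at `T = y`
  have h1 : f y ≤ LX + Y * Real.log y + Z * Real.log (Real.log y) :=
    hmain y hy3 y (by rwa [abs_of_pos hy0]) (by rw [abs_of_pos hy0])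
  have hlogy : Real.log y = Real.log t + Real.log (1 + x) := by
    rw [show 1 + x = y / t by simp only [hx]; ring, Real.log_div hy0.ne' ht0.ne']; ring
  have hd : Real.log (1 + x) ≤ g := log_one_add_le_cubic hx1
  have h2 : Real.log y ≤ Real.log t + g := by rw [hlogy]; linarith
  have h3 : Real.log (Real.log y) ≤ Real.log (Real.log t) + g / Real.log t := by
    have hq : 0 < Real.log y / Real.log t := div_pos hly hℓ
    have e1 : Real.log (Real.log y) = Real.log (Real.log t) + Real.log (Real.log y / Real.log t) := by
      rw [Real.log_div hly.ne' hℓ.ne']; ring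
    have e2 : Real.log (Real.log y / Real.log t) ≤ Real.log y / Real.log t - 1 :=
      Real.log_le_sub_one_of_pos hq
    have e3 : Real.log y / Real.log t - 1 = Real.log (1 + x) / Real.log t := by
      rw [hlogy]; field_simp; ring
    have e4 : Real.log (1 + x) / Real.log t ≤ g / Real.log t :=
      div_le_div_of_nonneg_right hd hℓ.le
    linarith
  have h4 : Y * Real.log y ≤ Y * (Real.log t + g) := mul_le_mul_of_nonneg_left h2 hY
  have h5 : Z * Real.log (Real.log y) ≤ Z * (Real.log (Real.log t) + g / Real.log t) :=
    mul_le_mul_of_nonneg_left h3 hZ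
  have e : LX + Y * (Real.log t + g) + Z * (Real.log (Real.log t) + g / Real.log t)
      = LX + Y * Real.log t + Z * Real.log (Real.log t) + (Y + Z / Real.log t) * g := by
    field_simp
    ring
  linarith

/-- **Lower range** `y ≤ −t` (`θ ≤ 1`): `f(y) ≤ log X + Y log t + Z log log t + (Y + Z/log t)(−y/t − 1)`
(the envelope at `T = |y|`, `log(1 + v) ≤ v`; Khale's Case 5, (5.10)).
[cite: Khale2024, Lemma 5.2 (proof)] [cite: Ford2002Millennium, proof of Lemma 3.4] -/
theorem le_lower (hY : 0 ≤ Y) (hZ : 0 ≤ Z) (ht : 3 ≤ t) (hθ1 : θ ≤ 1)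
    (hmain : ∀ T : ℝ, 3 ≤ T → ∀ y : ℝ, θ * t ≤ |y| → |y| ≤ T →
      f y ≤ LX + Y * Real.log T + Z * Real.log (Real.log T))
    {y : ℝ} (hy : y ≤ -t) :
    f y ≤ LX + Y * Real.log t + Z * Real.log (Real.log t) + (Y + Z / Real.log t) * (-y / t - 1) := by
  set v : ℝ := -y / t - 1 with hv
  have ht0 : 0 < t := by linarith
  have hT : 3 ≤ -y := by linarith
  have hT0 : 0 < -y := by linarith
  have hℓ : 0 < Real.log t := Real.log_pos (by linarith)
  have hly : 0 < Real.log (-y) := Real.log_pos (by linarith)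
  have hv0 : 0 ≤ v := by
    simp only [hv]; rw [le_sub_iff_add_le, zero_add, le_div_iff₀ ht0]; linarith
  have habs : |y| = -y := abs_of_neg (by linarith)
  have h1 : f y ≤ LX + Y * Real.log (-y) + Z * Real.log (Real.log (-y)) := by
    refine hmain (-y) hT y ?_ (by rw [habs])
    rw [habs]
    have : θ * t ≤ 1 * t := mul_le_mul_of_nonneg_right hθ1 ht0.le
    linarith
  have hlogy : Real.log (-y) = Real.log t + Real.log (1 + v) := by
    rw [show 1 + v = -y / t by simp only [hv]; ring, Real.log_div hT0.ne' ht0.ne']; ring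
  have hd : Real.log (1 + v) ≤ v := by
    have := Real.log_le_sub_one_of_pos (by linarith : 0 < 1 + v); linarith
  have h2 : Real.log (-y) ≤ Real.log t + v := by rw [hlogy]; linarith
  have h3 : Real.log (Real.log (-y)) ≤ Real.log (Real.log t) + v / Real.log t := by
    have hq : 0 < Real.log (-y) / Real.log t := div_pos hly hℓ
    have e1 : Real.log (Real.log (-y)) = Real.log (Real.log t) + Real.log (Real.log (-y) / Real.log t) := by
      rw [Real.log_div hly.ne' hℓ.ne']; ring
    have e2 : Real.log (Real.log (-y) / Real.log t) ≤ Real.log (-y) / Real.log t - 1 :=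
      Real.log_le_sub_one_of_pos hq
    have e3 : Real.log (-y) / Real.log t - 1 = Real.log (1 + v) / Real.log t := by
      rw [hlogy]; field_simp; ring
    have e4 : Real.log (1 + v) / Real.log t ≤ v / Real.log t := div_le_div_of_nonneg_right hd hℓ.le
    linarith
  have h4 : Y * Real.log (-y) ≤ Y * (Real.log t + v) := mul_le_mul_of_nonneg_left h2 hY
  have h5 : Z * Real.log (Real.log (-y)) ≤ Z * (Real.log (Real.log t) + v / Real.log t) :=
    mul_le_mul_of_nonneg_left h3 hZ
  have e : LX + Y * (Real.log t + v) + Z * (Real.log (Real.log t) + v / Real.log t)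
      = LX + Y * Real.log t + Z * Real.log (Real.log t) + (Y + Z / Real.log t) * v := by
    field_simp
    ring
  linarith

end pointwise

/-! ## The exceptional window -/

/-- **A window to the left of the origin**: for `α ≤ β ≤ 0` and a constant `K ≥ 0`,
`∫ 𝟙_{[α, β]}(u) K/cosh²u du ≤ K · 4e^{−2|β|} · (β − α)`. [cite: Khale2024, Lemma 5.2 (proof)] -/
theorem integral_window_le {K α β : ℝ} (hK : 0 ≤ K) (hαβ : α ≤ β) (hβ : β ≤ 0) :
    ∫ u : ℝ, (Set.Icc α β).indicator (fun _ ↦ K) u / Real.cosh u ^ 2 ≤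
      K * (4 * Real.exp (-(2 * |β|))) * (β - α) := by
  set Kc : ℝ := K * (4 * Real.exp (-(2 * |β|))) with hKc
  have hKc0 : 0 ≤ Kc := by positivity
  have hvol : volume (Set.Icc α β) = ENNReal.ofReal (β - α) := Real.volume_Icc
  have hG : Integrable ((Set.Icc α β).indicator fun _ ↦ Kc) :=
    (integrableOn_const (by rw [hvol]; exact ENNReal.ofReal_ne_top)).integrable_indicator
      measurableSet_Icc
  have hGint : ∫ u, (Set.Icc α β).indicator (fun _ ↦ Kc) u = Kc * (β - α) := by
    rw [integral_indicator_const _ measurableSet_Icc, Real.volume_real_Icc_of_le hαβ, smul_eq_mul]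
    ring
  rw [← hGint]
  refine integral_mono_of_nonneg (ae_of_all _ fun u ↦ ?_) hG (ae_of_all _ fun u ↦ ?_)
  · exact div_nonneg (Set.indicator_nonneg (fun _ _ ↦ hK) _) (by positivity)
  · dsimp only
    by_cases hu : u ∈ Set.Icc α β
    · rw [Set.indicator_of_mem hu, Set.indicator_of_mem hu]
      have habs : |β| ≤ |u| := by
        rw [abs_of_nonpos hβ, abs_of_nonpos (hu.2.trans hβ)]; linarith [hu.2]
      have hw := one_div_cosh_sq_le u
      have hexp : Real.exp (-(2 * |u|)) ≤ Real.exp (-(2 * |β|)) := Real.exp_le_exp.2 (by linarith)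
      calc K / Real.cosh u ^ 2 = K * (1 / Real.cosh u ^ 2) := by ring
        _ ≤ K * (4 * Real.exp (-(2 * |u|))) := mul_le_mul_of_nonneg_left hw hK
        _ ≤ Kc := by rw [hKc]; gcongr
    · rw [Set.indicator_of_notMem hu, Set.indicator_of_notMem hu, zero_div]

/-! ## Ford's mechanism for an arbitrary `f` with an exceptional window -/

set_option maxHeartbeats 800000 in
/-- **Ford's Lemma 3.4 mechanism with an exceptional window** (the engine of Khale's Lemma 5.2).
Let `f : ℝ → ℝ`, `LX ≥ 0`, `Y, Z ≥ 0` with `Y + Z ≥ 1/10`, `0 < a ≤ 1/2`, `t ≥ 100`, `θ ≤ 1/2`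
with `θt ≥ 3`.  Assume the envelope `f(y) ≤ LX + Y log T + Z log log T` for `θt ≤ |y| ≤ T`
(`T ≥ 3`), and on the window `|y| < θt` only `f(y) ≤ LX + Y log t + Z log log t + K` (`K ≥ 0`),
where the window's weight `w = 4e^{−2(1−θ)t/a} · 2θt/a` satisfies `K w ≤ a²/(240 t² log t)` and
`3w ≤ a²/(24t²)`.  Then `∫ f(t + au)/cosh²u du ≤ 2(LX + Y log t + Z log log t)`.
[cite: Khale2024, Lemma 5.2 (proof)] [cite: Ford2002Millennium, Lemma 3.4 (proof)] -/
theorem integral_div_cosh_sq_le_generic {f : ℝ → ℝ} {LX Y Z a t θ K : ℝ}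
    (hLX : 0 ≤ LX) (hY : 0 ≤ Y) (hZ : 0 ≤ Z) (hYZ : 1 / 10 ≤ Y + Z)
    (ha : 0 < a) (ha2 : a ≤ 1 / 2) (ht : 100 ≤ t) (hθ1 : θ ≤ 1 / 2) (hθt : 3 ≤ θ * t)
    (hmain : ∀ T : ℝ, 3 ≤ T → ∀ y : ℝ, θ * t ≤ |y| → |y| ≤ T →
      f y ≤ LX + Y * Real.log T + Z * Real.log (Real.log T))
    (hK : 0 ≤ K)
    (hwin : ∀ y : ℝ, |y| < θ * t → f y ≤ LX + Y * Real.log t + Z * Real.log (Real.log t) + K)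
    (hN1 : K * ((4 * Real.exp (-(2 * |(-((1 - θ) * t) / a)|))) * (-((1 - θ) * t) / a - -((1 + θ) * t) / a))
      ≤ 1 / (10 * Real.log t) * (a ^ 2 / (24 * t ^ 2)))
    (hN2 : 3 * ((4 * Real.exp (-(2 * |(-((1 - θ) * t) / a)|))) * (-((1 - θ) * t) / a - -((1 + θ) * t) / a))
      ≤ a ^ 2 / (24 * t ^ 2)) :
    ∫ u : ℝ, f (t + u * a) / Real.cosh u ^ 2 ≤ 2 * (LX + Y * Real.log t + Z * Real.log (Real.log t)) := by
  have ht0 : 0 < t := by linarith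
  have ht3 : 3 ≤ t := by linarith
  have hat : a ≤ t := by linarith
  have hθ1' : θ ≤ 1 := by linarith
  -- the constants `ℓ = log t`, `M₀`, `c = Y + Z/ℓ`
  have hℓ1 : 1 < Real.log t := by
    have h : Real.exp 1 < t :=
      lt_of_lt_of_le (by have := Real.exp_one_lt_d9; norm_num at this; linarith) ht
    have := Real.log_lt_log (Real.exp_pos 1) h
    rwa [Real.log_exp] at this
  have hℓ0 : 0 < Real.log t := by linarith
  have hlogℓ : 0 ≤ Real.log (Real.log t) := Real.log_nonneg hℓ1.le
  set M₀ : ℝ := LX + Y * Real.log t + Z * Real.log (Real.log t) with hM₀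
  have hM₀0 : 0 ≤ M₀ := by
    have := mul_nonneg hY hℓ0.le
    have := mul_nonneg hZ hlogℓ
    simp only [hM₀]; linarith
  set c : ℝ := Y + Z / Real.log t with hc
  have hc0 : 0 < c := by
    have h1 : (Y + Z) / Real.log t ≤ Y + Z / Real.log t := by
      rw [add_div]; linarith [div_le_self hY hℓ1.le]
    have h2 : 0 < (Y + Z) / Real.log t := div_pos (by linarith) hℓ0
    simp only [hc]; linarith
  have hcℓ : 1 / (10 * Real.log t) ≤ c := by
    have h1 : (Y + Z) / Real.log t ≤ Y + Z / Real.log t := by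
      rw [add_div]; linarith [div_le_self hY hℓ1.le]
    have h2 : 1 / (10 * Real.log t) ≤ (Y + Z) / Real.log t := by
      rw [div_le_div_iff₀ (by positivity) hℓ0]; nlinarith
    simp only [hc]; linarith
  -- the window `[α, β]` in the variable `u`
  set α : ℝ := -((1 + θ) * t) / a with hα
  set β : ℝ := -((1 - θ) * t) / a with hβ
  have hαβ : α ≤ β := by
    simp only [hα, hβ]; rw [div_le_div_iff_of_pos_right ha]; nlinarith
  have hβ0 : β ≤ 0 := by
    simp only [hβ]; exact div_nonpos_of_nonpos_of_nonneg (by nlinarith) ha.le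
  set Kw : ℝ := K + 3 * c with hKw
  have hKw0 : 0 ≤ Kw := by positivity
  have hxu : ∀ u : ℝ, |a * u / t| ≤ |u| := by
    intro u
    rw [show a * u / t = a / t * u by ring, abs_mul, abs_of_pos (div_pos ha ht0)]
    exact mul_le_of_le_one_left (abs_nonneg u) (by rw [div_le_one ht0]; linarith)
  -- Step 1: the pointwise bound by the majorant `M₀ + Kw 𝟙_{[α,β]} + c (P₁ + P₄)`
  have hLM : ∀ u : ℝ, f (t + u * a) ≤
      M₀ + (Set.Icc α β).indicator (fun _ ↦ Kw) u
        + c * (max (-(a * u / t) - 2) 0 + (Set.Ici ((3 - t) / a)).indicator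
            (fun u ↦ a * u / t - (a * u / t) ^ 2 / 2 + (a * u / t) ^ 3 / 3) u) := by
    intro u
    have hP1 : 0 ≤ max (-(a * u / t) - 2) 0 := le_max_right _ _
    have hW0 : 0 ≤ (Set.Icc α β).indicator (fun _ ↦ Kw) u := Set.indicator_nonneg (fun _ _ ↦ hKw0) _
    have hcP1 := mul_nonneg hc0.le hP1
    have hxy : (t + u * a) / t - 1 = a * u / t := by field_simp; ring
    have hP4zero : t + u * a < 3 → (Set.Ici ((3 - t) / a)).indicator
        (fun u ↦ a * u / t - (a * u / t) ^ 2 / 2 + (a * u / t) ^ 3 / 3) u = 0 := by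
      intro h
      refine Set.indicator_of_notMem (fun hu ↦ ?_) _
      rw [Set.mem_Ici, div_le_iff₀ ha] at hu
      linarith
    -- when the cubic indicator is on, the cubic is `≥ -3`
    have hP4ge : -3 ≤ (Set.Ici ((3 - t) / a)).indicator
        (fun u ↦ a * u / t - (a * u / t) ^ 2 / 2 + (a * u / t) ^ 3 / 3) u := by
      by_cases hu : u ∈ Set.Ici ((3 - t) / a)
      · rw [Set.indicator_of_mem hu]
        rw [Set.mem_Ici, div_le_iff₀ ha] at hu
        rcases le_or_gt (t + u * a) (2 * t) with h2 | h2
        · have hx1 : |a * u / t| ≤ 1 := by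
            rw [abs_le, le_div_iff₀ ht0, div_le_iff₀ ht0]; constructor <;> nlinarith
          have := abs_cubic_le hx1 le_rfl
          rw [abs_le] at this
          linarith [this.1]
        · -- `x ≥ 1`: the cubic is `≥ 5/6 > -3`
          have hx1 : 1 ≤ a * u / t := by rw [le_div_iff₀ ht0]; nlinarith
          nlinarith [sq_nonneg (a * u / t), sq_nonneg (a * u / t - 1)]
      · rw [Set.indicator_of_notMem hu]; norm_num
    rcases le_or_gt (θ * t) (t + u * a) with h3 | h3
    · -- `y ≥ θ t`: Taylor at `T = y`
      have hb := le_upper hY hZ ht3 hθt hmain h3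
      rw [hxy] at hb
      have hmem : u ∈ Set.Ici ((3 - t) / a) := by
        rw [Set.mem_Ici, div_le_iff₀ ha]; linarith
      rw [Set.indicator_of_mem hmem]
      simp only [hc] at hcP1 ⊢
      linarith
    · rcases lt_or_ge (-(θ * t)) (t + u * a) with h1 | h1
      · -- the window `|y| < θ t`
        have hb := hwin (t + u * a) (abs_lt.2 ⟨h1, h3⟩)
        have hmem : u ∈ Set.Icc α β := by
          simp only [hα, hβ, Set.mem_Icc]
          constructor
          · rw [div_le_iff₀ ha]; linarith
          · rw [le_div_iff₀ ha]; linarith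
        rw [Set.indicator_of_mem hmem]
        have h4 := mul_le_mul_of_nonneg_left hP4ge hc0.le
        simp only [hKw]
        nlinarith [h4, hcP1]
      · -- `y ≤ -θ t`
        have hP4 := hP4zero (by linarith)
        rw [hP4, add_zero]
        rcases le_or_gt (t + u * a) (-t) with h4 | h4
        · -- `y ≤ -t`
          have hb := le_lower hY hZ ht3 hθ1' hmain h4
          have hex : -(t + u * a) / t - 1 = -(a * u / t) - 2 := by field_simp; ring
          rw [hex] at hb
          have hmax : -(a * u / t) - 2 ≤ max (-(a * u / t) - 2) 0 := le_max_left _ _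
          have := mul_le_mul_of_nonneg_left hmax hc0.le
          linarith
        · -- `-t < y ≤ -θt`
          have hyt : |t + u * a| ≤ t := abs_le.2 ⟨by linarith, by linarith⟩
          have hy1 : θ * t ≤ |t + u * a| := by rw [abs_of_nonpos (by linarith)]; linarith
          have hb := le_main ht3 hmain hy1 hyt
          linarith
  -- Step 2: integrability of the pieces against `1/cosh²`
  have q0 : Integrable fun u : ℝ ↦ M₀ / Real.cosh u ^ 2 :=
    integrable_div_cosh_sq_of_le aestronglyMeasurable_const 0 (C := |M₀|) fun u ↦ by simp
  have q3 : Integrable fun u : ℝ ↦ (Set.Icc α β).indicator (fun _ ↦ Kw) u / Real.cosh u ^ 2 := by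
    refine integrable_div_cosh_sq_of_le (aestronglyMeasurable_const.indicator measurableSet_Icc) 0
      (C := |Kw|) fun u ↦ ?_
    have h := norm_indicator_le_norm_self (s := Set.Icc α β) (fun _ ↦ Kw) u
    rw [Real.norm_eq_abs, Real.norm_eq_abs] at h
    simpa using h
  have q1 : Integrable fun u : ℝ ↦ max (-(a * u / t) - 2) 0 / Real.cosh u ^ 2 := by
    refine integrable_div_cosh_sq_of_le
      ((Continuous.max (by fun_prop) continuous_const).aestronglyMeasurable) 1 (C := 2) fun u ↦ ?_
    rw [abs_of_nonneg (le_max_right _ _), pow_one]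
    refine max_le ?_ (by linarith [abs_nonneg u])
    have h2 : -(a * u / t) ≤ |u| := by linarith [neg_abs_le (a * u / t), hxu u]
    linarith [abs_nonneg u]
  have q4 : Integrable fun u : ℝ ↦ (Set.Ici ((3 - t) / a)).indicator
      (fun u ↦ a * u / t - (a * u / t) ^ 2 / 2 + (a * u / t) ^ 3 / 3) u / Real.cosh u ^ 2 :=
    integrable_indicator_cubic_div_cosh_sq ha hat measurableSet_Ici
  have q14 : Integrable fun u : ℝ ↦ max (-(a * u / t) - 2) 0 / Real.cosh u ^ 2
      + (Set.Ici ((3 - t) / a)).indicator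
          (fun u ↦ a * u / t - (a * u / t) ^ 2 / 2 + (a * u / t) ^ 3 / 3) u / Real.cosh u ^ 2 :=
    q1.add q4
  have q14c : Integrable fun u : ℝ ↦ c * (max (-(a * u / t) - 2) 0 / Real.cosh u ^ 2
      + (Set.Ici ((3 - t) / a)).indicator
          (fun u ↦ a * u / t - (a * u / t) ^ 2 / 2 + (a * u / t) ^ 3 / 3) u / Real.cosh u ^ 2) :=
    q14.const_mul _
  have q03 : Integrable fun u : ℝ ↦ M₀ / Real.cosh u ^ 2
      + (Set.Icc α β).indicator (fun _ ↦ Kw) u / Real.cosh u ^ 2 := q0.add q3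
  have hIM : Integrable fun u : ℝ ↦
      (M₀ / Real.cosh u ^ 2 + (Set.Icc α β).indicator (fun _ ↦ Kw) u / Real.cosh u ^ 2)
      + c * (max (-(a * u / t) - 2) 0 / Real.cosh u ^ 2
        + (Set.Ici ((3 - t) / a)).indicator
            (fun u ↦ a * u / t - (a * u / t) ^ 2 / 2 + (a * u / t) ^ 3 / 3) u / Real.cosh u ^ 2) :=
    q03.add q14c
  -- Step 3: the integral of the majorant
  have s1 := integral_add q03 q14c
  have s2 := integral_add q0 q3
  have s3 : ∫ u : ℝ, c * (max (-(a * u / t) - 2) 0 / Real.cosh u ^ 2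
      + (Set.Ici ((3 - t) / a)).indicator
          (fun u ↦ a * u / t - (a * u / t) ^ 2 / 2 + (a * u / t) ^ 3 / 3) u / Real.cosh u ^ 2)
      = c * ∫ u : ℝ, (max (-(a * u / t) - 2) 0 / Real.cosh u ^ 2
      + (Set.Ici ((3 - t) / a)).indicator
          (fun u ↦ a * u / t - (a * u / t) ^ 2 / 2 + (a * u / t) ^ 3 / 3) u / Real.cosh u ^ 2) :=
    integral_const_mul _ _
  have s4 := integral_add q1 q4
  have e0 : ∫ u : ℝ, M₀ / Real.cosh u ^ 2 = 2 * M₀ := by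
    have e : (fun u : ℝ ↦ M₀ / Real.cosh u ^ 2) = fun u ↦ M₀ * (1 / Real.cosh u ^ 2) :=
      funext fun u ↦ by ring
    rw [e, integral_const_mul, integral_inv_cosh_sq]
    ring
  have B3 := integral_window_le hKw0 hαβ hβ0
  have B1 := integral_lower_excess_le ha ht0
  have B4 := integral_upper_le ha ha2 ht
  have N1 := numerics_lower ha ha2 ht
  have N4 := numerics_upper ha ha2 ht
  have hq : 0 ≤ a ^ 2 / (12 * t ^ 2) := by positivity
  have h14 : (∫ u : ℝ, max (-(a * u / t) - 2) 0 / Real.cosh u ^ 2)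
      + (∫ u : ℝ, (Set.Ici ((3 - t) / a)).indicator
          (fun u ↦ a * u / t - (a * u / t) ^ 2 / 2 + (a * u / t) ^ 3 / 3) u / Real.cosh u ^ 2)
        ≤ -(a ^ 2 / (12 * t ^ 2)) := by
    have e : a ^ 2 / (4 * t ^ 2) = 3 * (a ^ 2 / (12 * t ^ 2)) := by ring
    linarith
  have h14c := mul_le_mul_of_nonneg_left h14 hc0.le
  -- the window: `Kw w = K w + 3 c w ≤ c a²/(24t²) + c a²/(24t²) = c a²/(12 t²)`
  have h3c : (∫ u : ℝ, (Set.Icc α β).indicator (fun _ ↦ Kw) u / Real.cosh u ^ 2)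
        ≤ c * (a ^ 2 / (12 * t ^ 2)) := by
    refine B3.trans ?_
    set w : ℝ := (4 * Real.exp (-(2 * |β|))) * (β - α) with hw
    have hw0 : 0 ≤ w := by simp only [hw]; exact mul_nonneg (by positivity) (by linarith)
    have hN1' : K * w ≤ 1 / (10 * Real.log t) * (a ^ 2 / (24 * t ^ 2)) := by
      simpa only [hw, hα, hβ] using hN1
    have hN2' : 3 * w ≤ a ^ 2 / (24 * t ^ 2) := by simpa only [hw, hα, hβ] using hN2
    have h1 : K * w ≤ c * (a ^ 2 / (24 * t ^ 2)) :=
      hN1'.trans (mul_le_mul_of_nonneg_right hcℓ (by positivity))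
    have h2 : 3 * c * w ≤ c * (a ^ 2 / (24 * t ^ 2)) := by
      have := mul_le_mul_of_nonneg_left hN2' hc0.le
      linarith [this]
    calc Kw * (4 * Real.exp (-(2 * |β|))) * (β - α) = K * w + 3 * c * w := by
          simp only [hKw, hw]; ring
      _ ≤ c * (a ^ 2 / (24 * t ^ 2)) + c * (a ^ 2 / (24 * t ^ 2)) := add_le_add h1 h2
      _ = c * (a ^ 2 / (12 * t ^ 2)) := by ring
  have hIMle : ∫ u : ℝ, (M₀ / Real.cosh u ^ 2 + (Set.Icc α β).indicator (fun _ ↦ Kw) u / Real.cosh u ^ 2)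
      + c * (max (-(a * u / t) - 2) 0 / Real.cosh u ^ 2
        + (Set.Ici ((3 - t) / a)).indicator
            (fun u ↦ a * u / t - (a * u / t) ^ 2 / 2 + (a * u / t) ^ 3 / 3) u / Real.cosh u ^ 2)
      ≤ 2 * M₀ := by
    rw [s1, s2, s3, s4, e0]
    linarith [h14c, h3c]
  -- Step 4: conclusion
  by_cases hint : Integrable fun u : ℝ ↦ f (t + u * a) / Real.cosh u ^ 2
  · refine le_trans (integral_mono hint hIM fun u ↦ ?_) hIMle
    have hc2 : 0 < Real.cosh u ^ 2 := by positivity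
    have h := div_le_div_of_nonneg_right (hLM u) hc2.le
    refine h.trans (le_of_eq ?_)
    ring
  · rw [integral_undef hint]
    linarith

/-! ## The inputs for `f(y) = log|L(σ + iy, χ)|` -/

/-- `Σ_{n ≥ 1} n^{−3/2} ≤ 3` (`1 + ∫_1^∞ x^{−3/2} dx`). [folklore] -/
theorem tsum_rpow_neg_three_halves_le :
    ∑' n : ℕ, ((n + 1 : ℕ) : ℝ) ^ (-(3 / 2 : ℝ)) ≤ 3 := by
  refine Real.tsum_le_of_sum_range_le (fun n ↦ by positivity) fun n ↦ ?_
  rcases Nat.eq_zero_or_pos n with rfl | hn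
  · simp
  -- `∑_{i < n} (i+1)^{-3/2} = 1 + ∑_{i ∈ Ico 1 n} (i+1)^{-3/2} ≤ 1 + ∫_1^n x^{-3/2} ≤ 3`
  rw [Finset.range_eq_Ico, Finset.sum_eq_sum_Ico_succ_bot hn]
  simp only [zero_add, Nat.cast_one, Real.one_rpow]
  have hn' : (1 : ℝ) ≤ n := by exact_mod_cast hn
  have hanti : AntitoneOn (fun x : ℝ ↦ x ^ (-(3 / 2 : ℝ))) (Set.Icc ((1 : ℕ) : ℝ) n) := by
    intro x hx y _ hxy
    rw [Nat.cast_one] at hx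
    exact Real.rpow_le_rpow_of_nonpos (lt_of_lt_of_le one_pos hx.1) hxy (by norm_num)
  have key := AntitoneOn.sum_le_integral_Ico (f := fun x : ℝ ↦ x ^ (-(3 / 2 : ℝ))) hn hanti
  have hint : ∫ x in ((1 : ℕ) : ℝ)..n, x ^ (-(3 / 2 : ℝ)) ≤ 2 := by
    rw [Nat.cast_one, integral_rpow (Or.inr ⟨by norm_num, by
      rw [Set.uIcc_of_le hn']; exact fun h ↦ by linarith [h.1]⟩)]
    rw [Real.one_rpow]
    have h1 : (0 : ℝ) ≤ (n : ℝ) ^ (-(3 / 2 : ℝ) + 1) := by positivity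
    have e : (-(3 / 2 : ℝ) + 1) = -(1 / 2) := by norm_num
    rw [e] at h1 ⊢
    rw [div_le_iff_of_neg (by norm_num)]
    linarith
  have hsum : ∑ i ∈ Finset.Ico 1 n, (((i + 1 : ℕ) : ℝ)) ^ (-(3 / 2 : ℝ)) ≤ 2 := by
    refine le_trans (le_of_eq ?_) (key.trans hint)
    rfl
  linarith

/-- **Khale's Case 1 input** (partial summation, cf. "`|L(s, χ)| ≤ 2q|s|`"): for `χ ≠ χ₀`,
`Re s ≥ 1/2`, `‖L(s, χ)‖ ≤ 3q‖s‖` (the tree's `DirichletAbel.norm_LFunction_le`: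
`‖L(s, χ)‖ ≤ q‖s‖ Σ n^{−σ−1} ≤ q‖s‖ Σ n^{−3/2}`). [cite: Khale2024, Lemma 5.2 (proof, Case 1)] -/
theorem norm_LFunction_le_three_mul {q : ℕ} [NeZero q] {χ : DirichletCharacter ℂ q} (hχ : χ ≠ 1)
    {s : ℂ} (hs : 1 / 2 ≤ s.re) : ‖χ.LFunction s‖ ≤ 3 * q * ‖s‖ := by
  have h := DirichletAbel.norm_LFunction_le (χ := χ) hχ (s := s) (by linarith)
  have hsum32 : Summable fun n : ℕ ↦ ((n + 1 : ℕ) : ℝ) ^ (-(3 / 2 : ℝ)) := by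
    have := (Real.summable_nat_rpow (p := -(3 / 2 : ℝ))).2 (by norm_num)
    exact (summable_nat_add_iff 1).2 this
  have hbase : ∀ n : ℕ, (1 : ℝ) ≤ ((n + 1 : ℕ) : ℝ) := fun n ↦ by exact_mod_cast Nat.succ_pos n
  have hterm : ∀ n : ℕ, ((n + 1 : ℕ) : ℝ) ^ (-s.re - 1) ≤ ((n + 1 : ℕ) : ℝ) ^ (-(3 / 2 : ℝ)) :=
    fun n ↦ Real.rpow_le_rpow_of_exponent_le (hbase n) (by linarith)
  have hsumσ : Summable fun n : ℕ ↦ ((n + 1 : ℕ) : ℝ) ^ (-s.re - 1) :=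
    Summable.of_nonneg_of_le (fun n ↦ by positivity) hterm hsum32
  have hle := hsumσ.tsum_le_tsum hterm hsum32
  calc ‖χ.LFunction s‖ ≤ q * ‖s‖ * ∑' n : ℕ, ((n + 1 : ℕ) : ℝ) ^ (-s.re - 1) := h
    _ ≤ q * ‖s‖ * 3 :=
        mul_le_mul_of_nonneg_left (hle.trans tsum_rpow_neg_three_halves_le) (by positivity)
    _ = 3 * q * ‖s‖ := by ring

/-- **Khale's Case 1** (`|t + au| ≤ 3`), non-principal `χ`: for `1/2 ≤ σ ≤ 1` and `|y| < 3`,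
`log|L(σ + iy, χ)| ≤ log q + 3` (`‖L‖ ≤ 3q‖s‖ ≤ 12q`). [cite: Khale2024, Lemma 5.2 (proof, (5.4))] -/
theorem log_norm_LFunction_le_near {q : ℕ} [NeZero q] {χ : DirichletCharacter ℂ q} (hχ : χ ≠ 1)
    {σ : ℝ} (hσ : 1 / 2 ≤ σ) (hσ1 : σ ≤ 1) {y : ℝ} (hy : |y| < 3) :
    Real.log ‖χ.LFunction (σ + y * I)‖ ≤ Real.log q + 3 := by
  have hq : (1 : ℝ) ≤ q := by exact_mod_cast NeZero.one_le
  set s : ℂ := (σ : ℂ) + y * I with hs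
  have hsre : s.re = σ := by simp [hs]
  have hsn : ‖s‖ ≤ 4 := by
    have h1 : ‖s‖ ≤ |s.re| + |s.im| := Complex.norm_le_abs_re_add_abs_im s
    have h2 : s.im = y := by simp [hs]
    rw [hsre, h2, abs_of_pos (by linarith)] at h1
    linarith
  have hL : ‖χ.LFunction s‖ ≤ 12 * q := by
    calc ‖χ.LFunction s‖ ≤ 3 * q * ‖s‖ := norm_LFunction_le_three_mul hχ (by rw [hsre]; exact hσ)
      _ ≤ 3 * q * 4 := by gcongr
      _ = 12 * q := by ring
  have h12 : Real.log 12 ≤ 3 := by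
    rw [Real.log_le_iff_le_exp (by norm_num)]
    have h1 := Real.exp_one_gt_d9
    have h3 : Real.exp 3 = Real.exp 1 ^ 3 := by rw [← Real.exp_nat_mul]; norm_num
    have h2 : (2.7 : ℝ) ^ 3 ≤ Real.exp 1 ^ 3 := pow_le_pow_left₀ (by norm_num) (by linarith) 3
    rw [h3]; nlinarith
  calc Real.log ‖χ.LFunction s‖ ≤ Real.log (12 * q) := log_norm_le_log (by linarith) hL
    _ = Real.log 12 + Real.log q := Real.log_mul (by norm_num) (by positivity)
    _ ≤ Real.log q + 3 := by linarith

/-- **The envelope** (Khale's (5.3) with the absorption of the second term of Lemma 5.1): under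
(2.4), for `q ≥ 3`, `1/2 ≤ σ < 1` with `1.92/(1 − σ) ≤ (log(t/100))^{2/3}` (from (5.1)), and
`3 ≤ |y| ≤ T` with `log(t/100) ≤ log T`:
`|L(σ + iy, χ)| ≤ (A + 1) q^{1−σ} T^{B(1−σ)^{3/2}} (log T)^{2/3}`.
[cite: Khale2024, Lemma 5.2 (proof, (5.3))] -/
theorem norm_LFunction_le_envelope {A B : ℝ} (hA : 0 ≤ A) (hB : 0 ≤ B) (hF : HasHurwitzFordBound A B)
    {q : ℕ} [NeZero q] (hq : 3 ≤ q) (χ : DirichletCharacter ℂ q) {σ t : ℝ} (hσ : 1 / 2 ≤ σ)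
    (hσ1 : σ < 1) (ht : 100 < t) (hD : 1.92 / (1 - σ) ≤ Real.log (t / 100) ^ (2 / 3 : ℝ))
    {y T : ℝ} (hy3 : 3 ≤ |y|) (hyT : |y| ≤ T) (hT : Real.log (t / 100) ≤ Real.log T) :
    ‖χ.LFunction (σ + y * I)‖ ≤
      (A + 1) * (q : ℝ) ^ (1 - σ) * T ^ (B * (1 - σ) ^ (3 / 2 : ℝ)) * Real.log T ^ (2 / 3 : ℝ) := by
  have h51 := KhaleL51.norm_LFunction_le hF hq χ hy3 hσ hσ1
  set Y : ℝ := B * (1 - σ) ^ (3 / 2 : ℝ) with hY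
  have hY0 : 0 ≤ Y := by positivity
  have hq1 : (1 : ℝ) ≤ q := by exact_mod_cast le_trans (by norm_num) hq
  have hq0 : (0 : ℝ) < q := by linarith
  have hT3 : 3 ≤ T := hy3.trans hyT
  have hT1 : 1 < T := by linarith
  have hlogT : 1 ≤ Real.log T := by
    rw [← Real.log_exp 1]
    exact Real.log_le_log (Real.exp_pos 1) (le_trans (by have := Real.exp_one_lt_d9; linarith) hT3)
  have hlogy0 : 0 < Real.log |y| := Real.log_pos (by linarith)
  have hlt100 : 0 < Real.log (t / 100) := Real.log_pos (by rw [lt_div_iff₀ (by norm_num)]; linarith)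
  have hqσ : 0 < (q : ℝ) ^ (1 - σ) := Real.rpow_pos_of_pos hq0 _
  -- monotonicity in `|y| ≤ T`
  have hm1 : |y| ^ Y ≤ T ^ Y := Real.rpow_le_rpow (abs_nonneg y) hyT hY0
  have hm2 : Real.log |y| ^ (2 / 3 : ℝ) ≤ Real.log T ^ (2 / 3 : ℝ) :=
    Real.rpow_le_rpow hlogy0.le (Real.log_le_log (by linarith) hyT) (by norm_num)
  have hTY : 1 ≤ T ^ Y := Real.one_le_rpow hT1.le hY0
  have hlT : 0 ≤ Real.log T ^ (2 / 3 : ℝ) := by positivity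
  -- the second term: `1.92 (q^{1-σ} - 1)/(1-σ) ≤ q^{1-σ} (log(t/100))^{2/3} ≤ q^{1-σ} T^Y (log T)^{2/3}`
  have hsec : 1.92 * (((q : ℝ) ^ (1 - σ) - 1) / (1 - σ)) ≤
      (q : ℝ) ^ (1 - σ) * T ^ Y * Real.log T ^ (2 / 3 : ℝ) := by
    have h1σ : 0 < 1 - σ := by linarith
    have h1 : ((q : ℝ) ^ (1 - σ) - 1) / (1 - σ) ≤ (q : ℝ) ^ (1 - σ) / (1 - σ) :=
      div_le_div_of_nonneg_right (by linarith) h1σ.le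
    have h2 : 1.92 * ((q : ℝ) ^ (1 - σ) / (1 - σ)) = (q : ℝ) ^ (1 - σ) * (1.92 / (1 - σ)) := by ring
    have h3 : Real.log (t / 100) ^ (2 / 3 : ℝ) ≤ Real.log T ^ (2 / 3 : ℝ) :=
      Real.rpow_le_rpow hlt100.le hT (by norm_num)
    calc 1.92 * (((q : ℝ) ^ (1 - σ) - 1) / (1 - σ)) ≤ 1.92 * ((q : ℝ) ^ (1 - σ) / (1 - σ)) := by
          nlinarith
      _ = (q : ℝ) ^ (1 - σ) * (1.92 / (1 - σ)) := h2
      _ ≤ (q : ℝ) ^ (1 - σ) * Real.log T ^ (2 / 3 : ℝ) :=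
          mul_le_mul_of_nonneg_left (hD.trans h3) hqσ.le
      _ = (q : ℝ) ^ (1 - σ) * 1 * Real.log T ^ (2 / 3 : ℝ) := by ring
      _ ≤ (q : ℝ) ^ (1 - σ) * T ^ Y * Real.log T ^ (2 / 3 : ℝ) := by gcongr
  -- the first term
  have hfst : A * (q : ℝ) ^ (1 - σ) * |y| ^ Y * Real.log |y| ^ (2 / 3 : ℝ) ≤
      A * (q : ℝ) ^ (1 - σ) * T ^ Y * Real.log T ^ (2 / 3 : ℝ) := by gcongr
  calc ‖χ.LFunction (σ + y * I)‖
      ≤ A * (q : ℝ) ^ (1 - σ) * |y| ^ Y * Real.log |y| ^ (2 / 3 : ℝ)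
          + 1.92 * (((q : ℝ) ^ (1 - σ) - 1) / (1 - σ)) := h51
    _ ≤ A * (q : ℝ) ^ (1 - σ) * T ^ Y * Real.log T ^ (2 / 3 : ℝ)
          + (q : ℝ) ^ (1 - σ) * T ^ Y * Real.log T ^ (2 / 3 : ℝ) := add_le_add hfst hsec
    _ = (A + 1) * (q : ℝ) ^ (1 - σ) * T ^ Y * Real.log T ^ (2 / 3 : ℝ) := by ring

/-- The logarithm of the envelope: for `A ≥ 0`, `q ≥ 1`, `σ ≤ 1`, `Y ≥ 0`, `T ≥ 3` the envelope
`(A+1) q^{1−σ} T^Y (log T)^{2/3}` is `≥ 1` and its logarithm is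
`log(A+1) + (1−σ) log q + Y log T + ⅔ log log T`. [folklore] -/
theorem log_envelope_eq {A : ℝ} (hA : 0 ≤ A) {q : ℕ} (hq : 1 ≤ q) {σ Y T : ℝ} (hσ1 : σ ≤ 1)
    (hY : 0 ≤ Y) (hT : 3 ≤ T) :
    1 ≤ (A + 1) * (q : ℝ) ^ (1 - σ) * T ^ Y * Real.log T ^ (2 / 3 : ℝ) ∧
    Real.log ((A + 1) * (q : ℝ) ^ (1 - σ) * T ^ Y * Real.log T ^ (2 / 3 : ℝ)) =
      Real.log (A + 1) + (1 - σ) * Real.log q + Y * Real.log T + 2 / 3 * Real.log (Real.log T) := by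
  have hq1 : (1 : ℝ) ≤ q := by exact_mod_cast hq
  have hq0 : (0 : ℝ) < q := by linarith
  have hX1 : 1 ≤ (A + 1) * (q : ℝ) ^ (1 - σ) := by
    have := Real.one_le_rpow hq1 (by linarith : 0 ≤ 1 - σ)
    nlinarith
  have hX0 : 0 < (A + 1) * (q : ℝ) ^ (1 - σ) := by linarith
  refine ⟨one_le_bound hX1 hT hY (by norm_num), ?_⟩
  have e1 := log_bound_eq (Y := Y) (Z := 2 / 3) hX0 (by linarith : 1 < T)
  have e2 : Real.log ((A + 1) * (q : ℝ) ^ (1 - σ)) = Real.log (A + 1) + (1 - σ) * Real.log q := by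
    rw [Real.log_mul (by linarith) (Real.rpow_pos_of_pos hq0 _).ne', Real.log_rpow hq0]
  rw [e1, e2]

/-! ## Numerics for `t ≥ e^{1938}`, `a ≤ 1/2`, `θ = 1/100` -/

/-- `e^{1938} ≥ 10^6`. [folklore] -/
theorem exp_1938_ge : (10 : ℝ) ^ 6 ≤ Real.exp 1938 := by
  have h1 : (2 : ℝ) ≤ Real.exp 1 := by have := Real.exp_one_gt_d9; linarith
  have h2 : Real.exp 1938 = Real.exp 1 ^ 1938 := by rw [← Real.exp_nat_mul]; norm_num
  rw [h2]
  calc (10 : ℝ) ^ 6 ≤ 2 ^ 20 := by norm_num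
    _ ≤ 2 ^ 1938 := pow_le_pow_right₀ (by norm_num) (by norm_num)
    _ ≤ Real.exp 1 ^ 1938 := pow_le_pow_left₀ (by norm_num) h1 1938

/-- The window weight: with `v = t/a`, `4e^{−1.98 v} · v/50 ≤ 58 / v⁵` (`v⁶e^{−v} ≤ 720`). [folklore] -/
theorem window_weight_le {a t : ℝ} (ha : 0 < a) (ht : 0 < t) :
    (4 * Real.exp (-(2 * |(-((1 - 1 / 100) * t) / a)|))) * (-((1 - 1 / 100) * t) / a - -((1 + 1 / 100) * t) / a)
      ≤ 58 / (t / a) ^ 5 := by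
  set v : ℝ := t / a with hv
  have hv0 : 0 < v := div_pos ht ha
  have e1 : -((1 - 1 / 100) * t) / a - -((1 + 1 / 100) * t) / a = v / 50 := by
    simp only [hv]; field_simp; ring
  have e2 : |(-((1 - 1 / 100) * t) / a)| = 99 / 100 * v := by
    rw [show -((1 - 1 / 100) * t) / a = -(99 / 100 * v) by simp only [hv]; ring, abs_neg,
      abs_of_pos (by positivity)]
  rw [e1, e2]
  have hexp : Real.exp (-(2 * (99 / 100 * v))) ≤ Real.exp (-v) := Real.exp_le_exp.2 (by linarith)
  have h6 : v ^ 6 * Real.exp (-v) ≤ 720 := by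
    have := pow_mul_exp_neg_le 6 hv0.le
    norm_num [Nat.factorial] at this
    exact this
  have hev : Real.exp (-v) ≤ 720 / v ^ 6 := by
    rw [le_div_iff₀ (by positivity)]; linarith [mul_comm (v ^ 6) (Real.exp (-v))]
  calc 4 * Real.exp (-(2 * (99 / 100 * v))) * (v / 50) ≤ 4 * (720 / v ^ 6) * (v / 50) := by
        gcongr; exact hexp.trans hev
    _ = (288 / 5) / v ^ 5 := by field_simp; ring
    _ ≤ 58 / v ^ 5 := by gcongr; norm_num

/-- **Numerical side condition 1** (the window against `a²/(240 t² log t)`): for `t ≥ e^{1938}`,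
`0 < a ≤ 1/2`, `K = 100000 log t + 3`. [cite: Khale2024, Lemma 5.2 (proof)] -/
theorem numerics_window₁ {a t : ℝ} (ha : 0 < a) (ha2 : a ≤ 1 / 2) (ht : Real.exp 1938 ≤ t) :
    (100000 * Real.log t + 3) *
        ((4 * Real.exp (-(2 * |(-((1 - 1 / 100) * t) / a)|))) *
          (-((1 - 1 / 100) * t) / a - -((1 + 1 / 100) * t) / a))
      ≤ 1 / (10 * Real.log t) * (a ^ 2 / (24 * t ^ 2)) := by
  have ht6 : (10 : ℝ) ^ 6 ≤ t := exp_1938_ge.trans ht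
  have h6 : (10 : ℝ) ^ 6 = 1000000 := by norm_num
  have ht0 : 0 < t := by linarith
  have hℓ1 : 1 ≤ Real.log t := by
    rw [← Real.log_exp 1]
    refine Real.log_le_log (Real.exp_pos 1) ?_
    have := Real.exp_one_lt_d9
    linarith
  have hℓ0 : 0 ≤ Real.log t := by linarith
  have hw := window_weight_le (a := a) ha ht0
  set v : ℝ := t / a with hv
  have hv0 : 0 < v := div_pos ht0 ha
  have hvt : 2 * t ≤ v := by
    rw [hv, le_div_iff₀ ha]; nlinarith
  have hK0 : 0 ≤ 100000 * Real.log t + 3 := by positivity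
  refine (mul_le_mul_of_nonneg_left hw hK0).trans ?_
  have ha2' : a ^ 2 / (24 * t ^ 2) = 1 / (24 * v ^ 2) := by
    simp only [hv]; field_simp
  rw [ha2', show (100000 * Real.log t + 3) * (58 / v ^ 5) = (100000 * Real.log t + 3) * 58 / v ^ 5 by ring,
    show 1 / (10 * Real.log t) * (1 / (24 * v ^ 2)) = 1 / (240 * Real.log t * v ^ 2) by
      field_simp; ring]
  rw [div_le_div_iff₀ (by positivity) (by positivity)]
  -- `ℓ ≤ 2√t` (Mathlib's `Real.log_le_rpow_div`), `√t² = t`, `v ≥ 2t`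
  have hℓ : Real.log t ≤ 2 * t ^ (1 / 2 : ℝ) := by
    have := Real.log_le_rpow_div ht0.le (by norm_num : (0 : ℝ) < 1 / 2)
    linarith
  have hsq : (t ^ (1 / 2 : ℝ)) ^ 2 = t := by
    rw [← Real.rpow_natCast, ← Real.rpow_mul ht0.le]; norm_num
  have hrt : 0 ≤ t ^ (1 / 2 : ℝ) := by positivity
  have h1 : (100000 * Real.log t + 3) ≤ 100003 * Real.log t := by linarith
  have h2 : Real.log t ^ 2 ≤ 4 * t := by nlinarith
  have hv3 : (2 * t) ^ 3 ≤ v ^ 3 := pow_le_pow_left₀ (by linarith) hvt 3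
  calc (100000 * Real.log t + 3) * 58 * (240 * Real.log t * v ^ 2)
      = 13920 * ((100000 * Real.log t + 3) * Real.log t) * v ^ 2 := by ring
    _ ≤ 13920 * (100003 * Real.log t * Real.log t) * v ^ 2 := by gcongr
    _ = 1392041760 * Real.log t ^ 2 * v ^ 2 := by ring
    _ ≤ 1392041760 * (4 * t) * v ^ 2 := by gcongr
    _ ≤ v ^ 3 * v ^ 2 := by
        refine mul_le_mul_of_nonneg_right ?_ (by positivity)
        have : 1392041760 * (4 * t) ≤ (2 * t) ^ 3 := by nlinarith
        linarith
    _ = 1 * v ^ 5 := by ring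

/-- **Numerical side condition 2** (`3w ≤ a²/(24t²)`): for `t ≥ e^{1938}`, `0 < a ≤ 1/2`.
[cite: Khale2024, Lemma 5.2 (proof)] -/
theorem numerics_window₂ {a t : ℝ} (ha : 0 < a) (ha2 : a ≤ 1 / 2) (ht : Real.exp 1938 ≤ t) :
    3 * ((4 * Real.exp (-(2 * |(-((1 - 1 / 100) * t) / a)|))) *
          (-((1 - 1 / 100) * t) / a - -((1 + 1 / 100) * t) / a))
      ≤ a ^ 2 / (24 * t ^ 2) := by
  have ht6 : (10 : ℝ) ^ 6 ≤ t := exp_1938_ge.trans ht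
  have h6 : (10 : ℝ) ^ 6 = 1000000 := by norm_num
  have ht0 : 0 < t := by linarith
  have hw := window_weight_le (a := a) ha ht0
  set v : ℝ := t / a with hv
  have hv0 : 0 < v := div_pos ht0 ha
  have hvt : 2 * t ≤ v := by
    rw [hv, le_div_iff₀ ha]; nlinarith
  refine (mul_le_mul_of_nonneg_left hw (by norm_num)).trans ?_
  have ha2' : a ^ 2 / (24 * t ^ 2) = 1 / (24 * v ^ 2) := by
    simp only [hv]; field_simp
  rw [ha2', show (3 : ℝ) * (58 / v ^ 5) = 174 / v ^ 5 by ring,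
    div_le_div_iff₀ (by positivity) (by positivity)]
  have hv1 : 2000000 ≤ v := by linarith
  calc 174 * (24 * v ^ 2) = 4176 * v ^ 2 := by ring
    _ ≤ v ^ 3 * v ^ 2 := by
        refine mul_le_mul_of_nonneg_right ?_ (by positivity)
        nlinarith
    _ = 1 * v ^ 5 := by ring

/-! ## Lemma 5.2 -/

/-- **Khale 2024, Lemma 5.2** (non-principal characters). Assume (2.4) with `A, B > 0`
(`HasHurwitzFordBound A B`). Let `q ≥ 3`, `χ ≠ χ₀` a Dirichlet character mod `q`, `σ ∈ [1/2, 1)`,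
`a ∈ (0, 1/2]`, and suppose (5.1): `1 − σ ≥ 1.92 (log(t/100))^{−2/3}`, `t ≥ q^{1/100000}`,
`t ≥ e^{1938}`. Then
`∫_{−∞}^{∞} log|L(σ + it + iau, χ)|/cosh²u du ≤ 2(log(A+1) + (1−σ) log q + B(1−σ)^{3/2} log t + ⅔ log log t)`.
[cite: Khale2024, Lemma 5.2] -/
theorem lemma52 {A B : ℝ} (hA : 0 < A) (hB : 0 < B) (hF : HasHurwitzFordBound A B)
    {q : ℕ} [NeZero q] (hq : 3 ≤ q) (χ : DirichletCharacter ℂ q) (hχ : χ ≠ 1)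
    {σ a t : ℝ} (hσ : 1 / 2 ≤ σ) (hσ1 : σ < 1) (ha : 0 < a) (ha2 : a ≤ 1 / 2)
    (h51a : 1.92 * Real.log (t / 100) ^ (-(2 / 3 : ℝ)) ≤ 1 - σ)
    (h51b : (q : ℝ) ^ (1 / 100000 : ℝ) ≤ t) (h51c : Real.exp 1938 ≤ t) :
    ∫ u : ℝ, Real.log ‖χ.LFunction ((σ : ℂ) + ((t + u * a : ℝ) : ℂ) * I)‖ / Real.cosh u ^ 2 ≤
      2 * (Real.log (A + 1) + (1 - σ) * Real.log q + B * (1 - σ) ^ (3 / 2 : ℝ) * Real.log t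
        + 2 / 3 * Real.log (Real.log t)) := by
  have ht6 : (10 : ℝ) ^ 6 ≤ t := exp_1938_ge.trans h51c
  have ht100 : (100 : ℝ) < t := by linarith [show (100 : ℝ) < 10 ^ 6 by norm_num]
  have ht0 : 0 < t := by linarith
  have hq1 : 1 ≤ q := le_trans (by norm_num) hq
  have hq1' : (1 : ℝ) ≤ q := by exact_mod_cast hq1
  have hq0 : (0 : ℝ) < q := by linarith
  set Y : ℝ := B * (1 - σ) ^ (3 / 2 : ℝ) with hY
  have hY0 : 0 ≤ Y := by positivity
  set LX : ℝ := Real.log (A + 1) + (1 - σ) * Real.log q with hLX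
  have hLX0 : 0 ≤ LX := by
    have h1 : 0 ≤ Real.log (A + 1) := Real.log_nonneg (by linarith)
    have h2 : 0 ≤ (1 - σ) * Real.log q := mul_nonneg (by linarith) (Real.log_nonneg hq1')
    simp only [hLX]; linarith
  -- (5.1a) as `1.92/(1-σ) ≤ (log(t/100))^{2/3}`
  have hlt100 : 0 < Real.log (t / 100) := Real.log_pos (by rw [lt_div_iff₀ (by norm_num)]; linarith)
  have hD : 1.92 / (1 - σ) ≤ Real.log (t / 100) ^ (2 / 3 : ℝ) := by
    have hpow : 0 < Real.log (t / 100) ^ (2 / 3 : ℝ) := Real.rpow_pos_of_pos hlt100 _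
    rw [Real.rpow_neg hlt100.le, ← div_eq_mul_inv] at h51a
    rw [div_le_iff₀ (by linarith)]
    rw [div_le_iff₀ hpow] at h51a
    linarith
  -- (5.1b) as `log q ≤ 100000 log t`
  have hlogq : Real.log q ≤ 100000 * Real.log t := by
    have h1 : Real.log ((q : ℝ) ^ (1 / 100000 : ℝ)) ≤ Real.log t :=
      Real.log_le_log (Real.rpow_pos_of_pos hq0 _) h51b
    rw [Real.log_rpow hq0] at h1
    linarith
  -- the envelope hypothesis
  have hmain : ∀ T : ℝ, 3 ≤ T → ∀ y : ℝ, 1 / 100 * t ≤ |y| → |y| ≤ T →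
      (fun y : ℝ ↦ Real.log ‖χ.LFunction ((σ : ℂ) + (y : ℂ) * I)‖) y ≤
        LX + Y * Real.log T + 2 / 3 * Real.log (Real.log T) := by
    intro T hT y hy1 hyT
    have hy3 : 3 ≤ |y| := le_trans (by linarith) hy1
    have hlogT : Real.log (t / 100) ≤ Real.log T :=
      Real.log_le_log (by positivity) (by linarith [hy1.trans hyT])
    have henv := norm_LFunction_le_envelope hA.le hB.le hF hq χ hσ hσ1 ht100 hD hy3 hyT hlogT
    obtain ⟨h1, h2⟩ := log_envelope_eq hA.le hq1 hσ1.le hY0 (σ := σ) (T := T) hT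
    have := log_norm_le_log h1 henv
    rw [h2] at this
    simp only [hLX]
    linarith
  -- the window hypothesis
  have hℓ1 : 1 ≤ Real.log t := by
    rw [← Real.log_exp 1]
    exact Real.log_le_log (Real.exp_pos 1) (le_trans (by have := Real.exp_one_lt_d9; linarith) ht100.le)
  have hK : 0 ≤ 100000 * Real.log t + 3 := by positivity
  have hwin : ∀ y : ℝ, |y| < 1 / 100 * t →
      (fun y : ℝ ↦ Real.log ‖χ.LFunction ((σ : ℂ) + (y : ℂ) * I)‖) y ≤
        LX + Y * Real.log t + 2 / 3 * Real.log (Real.log t) + (100000 * Real.log t + 3) := by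
    intro y hy
    have hM : 0 ≤ Y * Real.log t + 2 / 3 * Real.log (Real.log t) := by
      have := mul_nonneg hY0 (by linarith : 0 ≤ Real.log t)
      have := Real.log_nonneg hℓ1
      positivity
    rcases lt_or_ge |y| 3 with h3 | h3
    · -- Case 1 of the source
      have hb := log_norm_LFunction_le_near hχ hσ hσ1.le h3
      have hLA : 0 ≤ Real.log (A + 1) := Real.log_nonneg (by linarith)
      have hσq : 0 ≤ (1 - σ) * Real.log q := mul_nonneg (by linarith) (Real.log_nonneg hq1')
      show Real.log ‖χ.LFunction ((σ : ℂ) + (y : ℂ) * I)‖ ≤ _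
      simp only [hLX]
      linarith
    · -- Case 2 of the source: Lemma 5.1 at `T = t`
      have hyt : |y| ≤ t := by linarith
      have henv := norm_LFunction_le_envelope hA.le hB.le hF hq χ hσ hσ1 ht100 hD h3 hyt
        (Real.log_le_log (by positivity) (by linarith))
      obtain ⟨h1, h2⟩ := log_envelope_eq hA.le hq1 hσ1.le hY0 (σ := σ) (T := t) (by linarith)
      have := log_norm_le_log h1 henv
      rw [h2] at this
      show Real.log ‖χ.LFunction ((σ : ℂ) + (y : ℂ) * I)‖ ≤ _
      simp only [hLX]
      linarith
  -- the generic mechanism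
  have key := integral_div_cosh_sq_le_generic
    (f := fun y : ℝ ↦ Real.log ‖χ.LFunction ((σ : ℂ) + (y : ℂ) * I)‖)
    (LX := LX) (Y := Y) (Z := 2 / 3) (a := a) (t := t) (θ := 1 / 100) (K := 100000 * Real.log t + 3)
    hLX0 hY0 (by norm_num) (by linarith) ha ha2 (by linarith) (by norm_num) (by linarith)
    hmain hK hwin (numerics_window₁ ha ha2 h51c) (numerics_window₂ ha ha2 h51c)
  have e : LX + Y * Real.log t + 2 / 3 * Real.log (Real.log t) =
      Real.log (A + 1) + (1 - σ) * Real.log q + B * (1 - σ) ^ (3 / 2 : ℝ) * Real.log t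
        + 2 / 3 * Real.log (Real.log t) := by simp only [hLX, hY]
  rw [e] at key
  exact key

end KhaleL52

end Literature.NumberTheory.LFunctions
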